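import Summits.QuantumFields.YangMills.Theorems.BalabanUVNodesK0Stub1SectFWSlotAtRecord
import Summits.QuantumFields.YangMills.Theorems.BalabanUVNodesK0Stub1StraightQTransposeLetter
import Summits.QuantumFields.YangMills.Theorems.BalabanUVNodesK0Stub1MultiplierO1LetterAtRecord
import HarnessLib

/-!
# K0⁷ STUB 1 (`stub_prop8StepCoP13`), sub-target S4b — **THE W-SLOT OF SECT. F's `W` AT THE RECORD WITH PRINT's STRAIGHT AVERAGE IN THE MULTIPLIER TERM, MODULO TWO
# NUMERIC LETTERS (`θ₀`, `h₀`)** — the junction certificate of reading (R1) of `pub-ymgap-k0-s1-w4/LOCATED-Q0-COMB.md`: k0-s1-w2's capstone at the record in its `anyQ`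
# edition (p612123 `K0Stub1SectFWSlotAtRecord.exists_sectF_W_atRecord_of_numericLetters_anyQ`) INSTANTIATED with the multiplier of record `M := η^d•M_V` (p612514's
# normalisation of p598821's `M_V`), the multiplier term's average `Q := (Lʲη)•Q_V` (print's (45) `LʲηQ_j`, straight), and the unit output block weight `wB′ ≡ 1`; THREE of the
# five displayed numeric letters are then THEOREMS — `O₁` (p616957 `h3132_unitWeight_of_adm22_T4`), `q₀ = 2` (this seat's `hQt'_unitWeight_of_adjoint_T4`, for the capstone's
# own existential transpose `Qt`), `q = L` (`hQ_scaledStraight_of_adm22`) — and only `θ₀` ((73)ᵀ for `𝔇ᵗ`, the chart lane) and `h₀` ((46)ᵀ for `Hᵗ`) remain displayed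

Cell `pub-ymgap`, width seat `pub-ymgap-k0-s1-w4` g0′ (FILE 7).  `--kind proof --supports stmt-QuantumFields-20541 --as helper`; count-neutral.
[15] = [Balaban1985Variational]; [B6] = [Balaban1984PropagatorsII].

WHY.  The capstone's W-slot `hWq` bounds `w₃‖W Y‖` by `C₄r²`, `C₄ = θ₀O₁(4C₂ε + q) + q₀O₁(4C₂) + (1 + θ₀εh₀)(…)ℓ²`, the five numbers being hypotheses about the delivered
operators.  With the EML linearisation `Qlin` as the multiplier term's average, `q₀·O₁` is not k-uniform (LOCATED-Q0-COMB).  With print's straight `(Lʲη)•Q_V` there and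
`η^d•M_V` as multiplier, this seat's files give `O₁` (FILE 4), `q₀ = 2` at `wB′ ≡ 1` for WHATEVER transpose `Qt` the capstone produces (FILE 6: uniqueness from the
adjunction w.r.t. (27) and the block trace pairing, then the multi-level column mass of the straight averages) and `q = L` (FILE 6 §4, k0-s1-w3's contraction row).  THIS
FILE plugs them in: every structural hypothesis as in p612123, the pairings∕fibre letters∕right inverse∕`ε`-window as PARAMETERS (inhabited: k0-s1-w2's p6xxxxx
`sectF_W_atRecord_parameters_inhabited`, g0's `exists_fibreLetters`, p598821), `M_V` and `Q` as parameters WITH THEIR KERNEL FORMULAS (p598821 ∕ `FlatScalarExtension`), and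
the port thresholds of FILE 4; conclusion = p612123's, with `O₁, q₀, q` discharged.
HONEST SCOPE.  A composition of tree theorems by name (`exact`∕`refine`); whether Sect. F's functional at the record carries `(Lʲη)•Q_V` or `Qlin` in its multiplier term is the
(87)∕(128) junction of S2∕S4a — NOT asserted (this is reading R1, typed); `θ₀`, `h₀` stay displayed; nothing of [15] Sects. D–F's analysis asserted; `stub_prop8StepCoP13` ∕ K0⁷
NOT closed; N07 NOT discharged; counts unmoved (28∕28 · 5∕27); R4 closes the conditional finite-𝕋⁴ rung `BalabanLadder.UV` only, never the summit; the YM mass gap (Clay) is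
NOT proved by any of this; nothing continuum ∕ ℝ⁴ ∕ OS.  No `sorry`, no `def`, no `instance`, no `notation`.
References: [15] (27) p.282, (45)–(50) p.285, (55)–(58) pp.286–287, (63)–(73) pp.287–289, (87)–(90) p.291, Prop. 4 (97)–(98) pp.292–293, (152) p.301, (157)–(158) p.302;
[B6] (2.2) p.224, (2.35) p.228, Prop. 2.7 (2.149) p.249; [Balaban1987RG1] (0.1) p.251.
-/

noncomputable section

open scoped BigOperators Matrix.Norms.L2Operator Topology ContDiff
open NormedSpace Metric Set Filter

namespace Summit.QuantumFields.YangMills.Theorems.K0Stub1SectFWSlotAtRecordStraightQ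

open Literature.MathematicalPhysics.QuantumFieldTheory.Balaban1983to89
open Literature.MathematicalPhysics.QuantumFieldTheory.Balaban1983to89.T4Continuum (T4Family)
open Literature.MathematicalPhysics.QuantumFieldTheory.Balaban1983to89.B6SectADomainsV1 (Domains)
open Literature.MathematicalPhysics.QuantumFieldTheory.Balaban1983to89.B6SectAOperatorsV1 (BondIdx QE aE)
open Literature.MathematicalPhysics.QuantumFieldTheory.Balaban1983to89.B6SectAVectorModelV1 (EE)
open B4Sect5Torus (TSite)
open B9Eq39Adjoint (bondPair)
open B11Eq26ActionExpansion (V0)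
open Summit.QuantumFields.YangMills.Theorems.FlatCubeOpsText (Adm22)
open Summit.QuantumFields.YangMills.Theorems.K0FlatCubeOpsTextP (IsLevWeight)
open Summit.QuantumFields.YangMills.Theorems.Prop8Chart (chartLog)
open Summit.QuantumFields.YangMills.Theorems.K0Stub1SectFWSlotAtRecord (exists_sectF_W_atRecord_of_numericLetters_anyQ)
open Summit.QuantumFields.YangMills.Theorems.K0Stub1MultiplierO1LetterAtRecord (h3132_unitWeight_of_adm22_T4 smul_multiplier_symm)
open Summit.QuantumFields.YangMills.Theorems.K0Stub1StraightQTransposeLetter (hQt'_unitWeight_of_adjoint_T4 hQ_scaledStraight_of_adm22)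

/-- ★★★ **THE W-SLOT OF SECT. F's `W = (δ∕δA′)V` AT THE RECORD, PRINT's STRAIGHT AVERAGE IN THE MULTIPLIER TERM, MODULO `θ₀` AND `h₀`** (reading R1; see the module docstring):
for every `F : T4Family` there are the port thresholds `Mh₀, R₀` and ONE constant `O₁ ≥ 0` such that at every admissible family `Dm` of the record's tori in the standing range
(`1 ≤ K − n′`, `K − n′ + 1 ≤ m + K`, `M_h = L^{a′} ≥ Mh₀`, `R ≥ R₀`, `R ≥ 2L`, `a′ + 3 ≤ m + n′`, `Adm22 Dm R (L·M_h)`, `Dm.k = K − n′`, `𝔅 ≠ ∅`), for the structural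
PARAMETERS of p612123 (`H hHinv B₀ hHB B₁ hHgrad ε h18 h2 τ ρ … BE hBE B hB hBsymm`), the multiplier `M_V` of p598821 by its kernel (`c = L^{K−n′}`, any auxiliary weights,
`B`-symmetric) and the straight average `Q` by its kernel `(L^{j(t)}η)·Q_{j(t)}(t,j)`: p612123's conclusion with `MV := η^d•M_V`, `wB′ := 1`, `O₁` := FILE 4's, `q₀ := 2`,
`q := L` — i.e. `∀ θ₀ h₀ ℓ` + the two letters (73)ᵀ, (46)ᵀ ⇒ `∃ e W` with the (63)-certificate, `hWd`, and `w 3 b·‖W Y b‖ ≤ (θ₀O₁(4C₂ε + L) + 2·O₁·4C₂ + (1 + θ₀εh₀)(…)ℓ²)·r²`.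
[cite: Balaban1985Variational, Prop. 4 (97)-(98) pp.292-293, (157)-(158) p.302, (63) p.287, (87)-(90) p.291, (27) p.282, (45)-(50) p.285, (55)-(58) pp.286-287, (73) p.289, (152) p.301; Balaban1984PropagatorsII, (2.2) p.224, (2.35) p.228, Prop. 2.7 (2.149) p.249; Balaban1987RG1, (0.1) p.251] -/
theorem exists_sectF_W_atRecord_straightQ (N : ℕ) [NeZero N] (F : T4Family) :
    ∃ (Mh₀ R₀ : ℕ) (O₁ : ℝ), 0 ≤ O₁ ∧
    ∀ (n' K : ℕ) (_ : 1 ≤ K - n') (_ : K - n' + 1 ≤ F.m + K) {Mh R a' : ℕ} (_ : Mh = F.L ^ a') (_ : Mh₀ ≤ Mh) (_ : R₀ ≤ R) (_ : 2 * F.L ≤ R)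
      (_ : a' + 3 ≤ F.m + n') (Dm : Domains (F.P K)) (hDk : Dm.k = K - n') (_ : Adm22 Dm R (F.L * Mh)) (_ : Nonempty (BondIdx Dm))
      {w : ℕ → PBond (F.P K) 0 → ℝ} (hw : IsLevWeight (F.P K) (K - n') Dm w)
      [Fact ((0 : ℝ) < ((F.P K).L : ℝ))] [Fact ((0 : ℝ) < (((F.P K).L : ℝ))⁻¹ ^ (K - n'))]
      -- the right inverse `H` of the true linearisation with BOTH (46) rows
      (H : (BondIdx Dm → Matrix (Fin N) (Fin N) ℂ) →ₗ[ℂ] (PBond (F.P K) 0 → Matrix (Fin N) (Fin N) ℂ))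
      (hHinv : ∀ X, (fderiv ℂ (chartLog ((((F.P K).L : ℝ)⁻¹) ^ (K - n')) Dm : (PBond (F.P K) 0 → Matrix (Fin N) (Fin N) ℂ) → BondIdx Dm → Matrix (Fin N) (Fin N) ℂ) 0) (H X) = X)
      {B₀ : ℝ} (hB₀ : 0 ≤ B₀)
      (hHB : ∀ (X : BondIdx Dm → Matrix (Fin N) (Fin N) ℂ) (t : ℝ), 0 ≤ t → (∀ i, ‖X i‖ ≤ t) → ∀ b, w 1 b * ‖H X b‖ ≤ B₀ * t)
      {B₁ : ℝ} (hB₁ : 0 ≤ B₁)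
      (hHgrad : ∀ (X : BondIdx Dm → Matrix (Fin N) (Fin N) ℂ) (t : ℝ), 0 ≤ t → (∀ i, ‖X i‖ ≤ t) →
        ∀ (b : PBond (F.P K) 0) (ν : Fin (F.P K).d), w 2 b * ((F.P K).L : ℝ) ^ (K - n') * ‖H X ⟨b.src.shift ν, b.dir⟩ - H X b‖ ≤ B₁ * t)
      -- the `ε`-window
      {ε : ℝ} (hε : 0 < ε) (h18 : 18 * (960 * ((((F.P K).d + 2) * (F.P K).L : ℕ) : ℝ) * ((F.P K).L : ℝ) / (12800 * ((((F.P K).d + 2) * (F.P K).L : ℕ) : ℝ) ^ 2 * ((F.P K).L : ℝ))⁻¹) * B₀ * ε ≤ 1)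
      (h2 : 64 * ε ≤ (12800 * ((((F.P K).d + 2) * (F.P K).L : ℕ) : ℝ) ^ 2 * ((F.P K).L : ℝ))⁻¹)
      -- the fibre letters
      (τ : Matrix (Fin N) (Fin N) ℂ →L[ℂ] ℂ) (ρ : (Matrix (Fin N) (Fin N) ℂ →L[ℂ] ℂ) →L[ℂ] Matrix (Fin N) (Fin N) ℂ)
      (hρ : ∀ (ℓ' : Matrix (Fin N) (Fin N) ℂ →L[ℂ] ℂ) (X : Matrix (Fin N) (Fin N) ℂ), τ (ρ ℓ' * X) = ℓ' X)
      (hτ : ∀ a b : Matrix (Fin N) (Fin N) ℂ, τ (a * b) = τ (b * a)) (hτs : ∀ a : Matrix (Fin N) (Fin N) ℂ, τ (star a) = starRingEnd ℂ (τ a))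
      (hτ1 : ∀ X : Matrix (Fin N) (Fin N) ℂ, ‖τ X‖ ≤ ‖X‖) {Mρ : ℝ} (hMρ : 0 ≤ Mρ) (hρn : ∀ ℓ' : Matrix (Fin N) (Fin N) ℂ →L[ℂ] ℂ, ‖ρ ℓ'‖ ≤ Mρ * ‖ℓ'‖)
      -- the pairings (27) ∕ block trace
      (BE : (PBond (F.P K) 0 → Matrix (Fin N) (Fin N) ℂ) →L[ℂ] (PBond (F.P K) 0 → Matrix (Fin N) (Fin N) ℂ) →L[ℂ] ℂ)
      (hBE : ∀ Y δ : PBond (F.P K) 0 → Matrix (Fin N) (Fin N) ℂ, BE Y δ =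
        bondPair ((((F.P K).L : ℝ))⁻¹ ^ (K - n')) (F.P K).d (τ : Matrix (Fin N) (Fin N) ℂ →ₗ[ℂ] ℂ) (fun μ x => Y ⟨x, μ⟩) (fun μ x => δ ⟨x, μ⟩))
      (B : (BondIdx Dm → Matrix (Fin N) (Fin N) ℂ) →L[ℂ] (BondIdx Dm → Matrix (Fin N) (Fin N) ℂ) →L[ℂ] ℂ)
      (hB : ∀ X X' : BondIdx Dm → Matrix (Fin N) (Fin N) ℂ, B X X' = ∑ t, τ (X t * X' t)) (hBsymm : ∀ a b, B a b = B b a)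
      -- the multiplier `M_V` of p598821 (kernel, `c = L^{K−n′}`, any auxiliary weights) and the straight average `(Lʲη)•Q_V` (kernel)
      (hc : ((F.P K).L : ℝ) ^ (K - n') ≠ 0) {aw : BondIdx Dm → ℝ} (haw : ∀ i, 0 < aw i)
      (MV : (BondIdx Dm → Matrix (Fin N) (Fin N) ℂ) →L[ℂ] (BondIdx Dm → Matrix (Fin N) (Fin N) ℂ))
      (_ : ∀ (X : BondIdx Dm → Matrix (Fin N) (Fin N) ℂ) (t : BondIdx Dm),
        MV X t = ∑ s, ((WithLp.ofLp ((EE Dm hc haw - aE Dm aw) (WithLp.toLp 2 (Pi.single s 1))) t : ℝ) : ℂ) • X s)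
      (_ : ∀ a b, B (MV a) b = B a (MV b))
      (Q : (PBond (F.P K) 0 → Matrix (Fin N) (Fin N) ℂ) →L[ℂ] (BondIdx Dm → Matrix (Fin N) (Fin N) ℂ))
      (_ : ∀ (A : PBond (F.P K) 0 → Matrix (Fin N) (Fin N) ℂ) (t : BondIdx Dm), Q A t =
        ∑ j, ((((F.P K).L : ℝ) ^ (t.1.1 : ℕ) * (((F.P K).L : ℝ)⁻¹) ^ (K - n') * WithLp.ofLp (QE Dm (WithLp.toLp 2 (Pi.single j 1))) t : ℝ) : ℂ) • A j),
    let η : ℝ := (((F.P K).L : ℝ)⁻¹) ^ (K - n')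
    let C₂ : ℝ := (960 * ((((F.P K).d + 2) * (F.P K).L : ℕ) : ℝ) * ((F.P K).L : ℝ) / (12800 * ((((F.P K).d + 2) * (F.P K).L : ℕ) : ℝ) ^ 2 * ((F.P K).L : ℝ))⁻¹)
    let Qlin := (fderiv ℂ (chartLog η Dm : (PBond (F.P K) 0 → Matrix (Fin N) (Fin N) ℂ) → BondIdx Dm → Matrix (Fin N) (Fin N) ℂ) 0)
    ∃ (Qt : (BondIdx Dm → Matrix (Fin N) (Fin N) ℂ) →L[ℂ] (PBond (F.P K) 0 → Matrix (Fin N) (Fin N) ℂ)) (Ht : (PBond (F.P K) 0 → Matrix (Fin N) (Fin N) ℂ) →L[ℂ] (BondIdx Dm → Matrix (Fin N) (Fin N) ℂ))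
      (Dfun : (PBond (F.P K) 0 → Matrix (Fin N) (Fin N) ℂ) → (BondIdx Dm → Matrix (Fin N) (Fin N) ℂ))
      (Dt : (PBond (F.P K) 0 → Matrix (Fin N) (Fin N) ℂ) → ((BondIdx Dm → Matrix (Fin N) (Fin N) ℂ) →L[ℂ] (PBond (F.P K) 0 → Matrix (Fin N) (Fin N) ℂ))),
      (∀ X δ, BE (Qt X) δ = B X (Q δ)) ∧ (∀ Z X, BE Z (H X) = B (Ht Z) X) ∧
      (∀ A' : PBond (F.P K) 0 → Matrix (Fin N) (Fin N) ℂ, (∀ b, w 1 b * ‖A' b‖ < ε) →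
        (∀ ρ' : ℝ, 0 ≤ ρ' → (∀ b, w 1 b * ‖A' b‖ ≤ ρ') → ∀ i, ‖Dfun A' i‖ ≤ 4 * C₂ * ρ' ^ 2) ∧
        chartLog η Dm (A' - H (Dfun A')) - Qlin (A' - H (Dfun A')) = Dfun A' ∧
        chartLog η Dm (A' - H (Dfun A')) = Qlin A') ∧
      ContDiffOn ℂ ω Dfun {Y : PBond (F.P K) 0 → Matrix (Fin N) (Fin N) ℂ | ∀ b, w 1 b * ‖Y b‖ < ε} ∧
      (∀ (A' : PBond (F.P K) 0 → Matrix (Fin N) (Fin N) ℂ) X δ, BE (Dt A' X) δ = B X (fderiv ℂ Dfun A' δ)) ∧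
      -- ★ THE W-SLOT MODULO `θ₀`, `h₀` ONLY
      ∀ (θ₀ h₀ ℓ : ℝ), 0 ≤ θ₀ → 0 ≤ h₀ → 1 + B₀ * (4 * C₂) * ε ≤ ℓ → 1 + B₁ * (4 * C₂) * ε ≤ ℓ → ℓ * ε ≤ 1 / 16 →
        -- (73)ᵀ for `Dt` (unit block weight)
        (∀ (A' : PBond (F.P K) 0 → Matrix (Fin N) (Fin N) ℂ) (r : ℝ), (∀ b, w 1 b * ‖A' b‖ ≤ r) →
          (∀ (b : PBond (F.P K) 0) (ν : Fin (F.P K).d), w 2 b * ((F.P K).L : ℝ) ^ (K - n') * ‖A' ⟨b.src.shift ν, b.dir⟩ - A' b‖ ≤ r) → r < ε →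
          ∀ (X : BondIdx Dm → Matrix (Fin N) (Fin N) ℂ) (s : ℝ), (∀ i, (1 : ℝ) * ‖X i‖ ≤ s) → ∀ b, w 3 b * ‖Dt A' X b‖ ≤ θ₀ * r * s) →
        -- (46)ᵀ for `Ht` (unit block weight)
        (∀ (Z : PBond (F.P K) 0 → Matrix (Fin N) (Fin N) ℂ) (s : ℝ), (∀ b, w 3 b * ‖Z b‖ ≤ s) → ∀ i, (1 : ℝ) * ‖Ht Z i‖ ≤ h₀ * s) →
        ∃ (e : Site (F.P K) 0 ≃ TSite (F.P K).d (fun _ => (F.P K).sitesPerDir 0)) (W : (PBond (F.P K) 0 → Matrix (Fin N) (Fin N) ℂ) → (PBond (F.P K) 0 → Matrix (Fin N) (Fin N) ℂ)),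
          (∀ (x : Site (F.P K) 0) (μ : Fin (F.P K).d), e (x.shift μ) = B9SectCLatticeCarrier.shift μ (e x)) ∧
          (∀ A' : PBond (F.P K) 0 → Matrix (Fin N) (Fin N) ℂ, (∀ b, w 1 b * ‖A' b‖ < ε) →
            (∀ (b : PBond (F.P K) 0) (ν : Fin (F.P K).d), w 2 b * ((F.P K).L : ℝ) ^ (K - n') * ‖A' ⟨b.src.shift ν, b.dir⟩ - A' b‖ < ε) →
            HasFDerivAt (fun A : PBond (F.P K) 0 → Matrix (Fin N) (Fin N) ℂ => 2⁻¹ * B (Dfun A) ((((η : ℂ) ^ (F.P K).d) • MV) (Dfun A)) - B (Q A) ((((η : ℂ) ^ (F.P K).d) • MV) (Dfun A))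
                + V0 (LatticeFieldCalculus.shiftEquiv (P := F.P K) (j := 0)) (fun _ _ => (1 : (Matrix (Fin N) (Fin N) ℂ)ˣ)) η (F.P K).d
                    (τ : Matrix (Fin N) (Fin N) ℂ →ₗ[ℂ] ℂ) (fun μ x => (A - H (Dfun A)) ⟨x, μ⟩))
              (BE (W A')) A') ∧
          DifferentiableOn ℂ W {Y : PBond (F.P K) 0 → Matrix (Fin N) (Fin N) ℂ | (∀ b, w 1 b * ‖Y b‖ < ε) ∧
            ∀ (b : PBond (F.P K) 0) (ν : Fin (F.P K).d), w 2 b * ((F.P K).L : ℝ) ^ (K - n') * ‖Y ⟨b.src.shift ν, b.dir⟩ - Y b‖ < ε} ∧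
          (∀ (Y : PBond (F.P K) 0 → Matrix (Fin N) (Fin N) ℂ) (r : ℝ), r < ε → (∀ b, w 1 b * ‖Y b‖ ≤ r) →
            (∀ (b : PBond (F.P K) 0) (ν : Fin (F.P K).d), w 2 b * ((F.P K).L : ℝ) ^ (K - n') * ‖Y ⟨b.src.shift ν, b.dir⟩ - Y b‖ ≤ r) →
            ∀ b, w 3 b * ‖W Y b‖ ≤
              (θ₀ * O₁ * (4 * C₂ * ε + ((F.P K).L : ℝ)) + 2 * O₁ * (4 * C₂)
                + (1 + θ₀ * ε * h₀) * ((((F.P K).d - 1 : ℕ) : ℝ) * (((F.P K).L : ℝ) ^ 2) ^ 3 * Mρ * (200 + 2 * ((F.P K).L : ℝ) ^ 2)) * ℓ ^ 2)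
                * r ^ 2) := by
  obtain ⟨Mh₀, R₀, O₁, hO₁, h4⟩ := h3132_unitWeight_of_adm22_T4 F
  refine ⟨Mh₀, R₀, O₁, hO₁, ?_⟩
  intro n' K hk1 hk' Mh R a' hMha hMh hR hRL hsize Dm hDk hAdm hne w hw _ _ H hHinv B₀ hB₀ hHB B₁ hB₁ hHgrad ε hε h18 h2 τ ρ hρ hτ hτs hτ1 Mρ hMρ hρn
    BE hBE B hB hBsymm hc aw haw MV hMV hMsym Q hQ η C₂ Qlin
  have hd : 4 ≤ (F.P K).d := le_of_eq (T4Family.P_d F K).symm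
  have hL0 : (0 : ℝ) < ((F.P K).L : ℝ) := by exact_mod_cast (F.P K).L_pos
  have hMh1 : 1 ≤ Mh := by rw [hMha]; exact Nat.one_le_pow _ _ (F.P K).L_pos
  have hM1 : 1 ≤ F.L * Mh := Nat.le_mul_of_pos_right _ hMh1 |>.trans' (F.P K).L_pos
  have hRL' : 2 * (F.P K).L ≤ R := hRL
  have hRM : 2 * (F.P K).L ≤ R * (F.L * Mh) :=
    le_trans hRL' (Nat.le_mul_of_pos_right R hM1)
  -- p612123's `anyQ` capstone at `MV := η^d•M_V`, `Q := (Lʲη)•Q_V`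
  obtain ⟨Qt, Ht, Dfun, Dt, hQt, hHt, hpt, hcd, hDt, main⟩ :=
    exists_sectF_W_atRecord_of_numericLetters_anyQ N (F.P K) hd (K - n') hRL' hM1 Dm hDk hAdm hw H hHinv hB₀ hHB hB₁ hHgrad hε h18 h2 τ ρ hρ hτ hτs hτ1 hMρ hρn
      BE hBE B hB hBsymm ((((η : ℂ) ^ (F.P K).d)) • MV) (smul_multiplier_symm B MV hMsym _) Q
  refine ⟨Qt, Ht, Dfun, Dt, hQt, hHt, hpt, hcd, hDt, ?_⟩
  intro θ₀ h₀ ℓ hθ₀ hh₀ hℓ₀ hℓ₁ hℓa h73t h46t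
  refine main (fun _ => (1 : ℝ)) O₁ 2 θ₀ h₀ ℓ ((F.P K).L : ℝ) hO₁ hθ₀ hh₀ hℓ₀ hℓ₁ hℓa ?_ ?_ h73t h46t ?_
  · -- `O₁`: FILE 4 (p616957) at the unit block weight
    exact fun X s hX i => h4 n' K hk1 hk' hMha hMh hR hsize Dm hDk hAdm hc haw MV hMV X s hX i
  · -- `q₀ = 2`: FILE 6, for the capstone's own transpose `Qt` (uniqueness from the adjunction)
    intro X s hX b
    obtain ⟨i₀⟩ := hne
    have hs : 0 ≤ s := le_trans (by rw [one_mul]; exact norm_nonneg _) (hX i₀)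
    exact hQt'_unitWeight_of_adjoint_T4 F n' K Dm hDk hw τ ρ hρ hτ BE hBE B hB
      (fun t => ((F.P K).L : ℝ) ^ (t.1.1 : ℕ) * (((F.P K).L : ℝ)⁻¹) ^ (K - n')) (fun t => le_of_eq (abs_of_nonneg (by positivity))) Q hQ Qt hQt X s hs hX b
  · -- `q = L`: FILE 6 §4 (k0-s1-w3's contraction row)
    exact hQ_scaledStraight_of_adm22 (K - n') Dm hDk hAdm hRM hw (fun A => Q A) hQ

end Summit.QuantumFields.YangMills.Theorems.K0Stub1SectFWSlotAtRecordStraightQ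

end
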